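import Literature.NumberTheory.LFunctions.Zhang2022.ObjectiveTwinDetAfeK13
import Literature.NumberTheory.LFunctions.Zhang2022.RepairIntakeBmultiMembers
import Literature.NumberTheory.LFunctions.Zhang2022.MainTermFormEllPairs

/-!
# Zhang (2022) design-space objective, twin part 18: TWO-TERM exponential witnesses `x·k_p + z·k_q` for ANY
# detector recipe — the atom calculus for two arbitrary integer frequencies, and the §D full-gap EDGE sequence

Y. Zhang, *Discrete mean estimates and the Landau–Siegel zero*, arXiv:2211.02515v1 (2022)
[Zhang2022LandauSiegel] — an unrefereed manuscript under adjudication. **This file SEARCHES and TYPES; it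
makes no claim about Landau–Siegel zeros, about Theorems 1–2 of the manuscript, or about a repaired (2.32),
until a kernel theorem says so.** LANDAU–SIEGEL programme, cell `landau-siegel`, §A Lean twin serving §D (edge ell,
card «ell-vernier-far-pair»; ls-Bmulti-num-1 g4 2026-08-27T01:20:50Z: on ls-ref-1's 63 EDGE cells the certified
negative witness is always the two-term near-against-far profile `k₁ ∓ k_J`; kit j264345 TWOTERM-A.md 173b64675c2dfc52).

Parts 16–17 gave formula I of any recipe on `span{k₁,k₂,k₃}`. Here the frequencies are ARBITRARY naturals
`1 ≤ p < q`: for `u = x·k_p + z·k_q` (`k_j(y) = e^{−iπjy} = afeDir j`) the six atoms of `Det.formDet_eq_moments` are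
computed in closed form from the three mode integrals `E(j) = ∫₀¹ k_j = ((−1)^j − 1)/c_j` (`c_j = afeFreq j = −iπj`;
`integral_afeDir_eq`), `j ∈ {p, q, q−p}` (mode integrals via ls-Bell-typer's `integral_modes5`, `MainTermFormEllPairs`):
* `integral_normSq_twoTerm` (`‖u‖² = |x|² + |z|² + zx̄·E(q−p) + xz̄·Ē(q−p)`), `integral_twoTerm'_mul_conj` (`⟨u′,u⟩`),
  `integral_normSq_twoTerm'` (`‖u′‖²`), `integral_twoTerm` (`∫u = xE(p) + zE(q)`),
  `integral_twoTerm_mul_conj_primitive` (`⟨u, S_u⟩`), `kinkedProfile_twoTerm`;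
* **`Det.formDet_recipe_twoTerm`** — for ANY recipe `R` and any two-term one-sided profile (`x(−1)^p + z(−1)^q = 0`),
  `FormDet R u` as the explicit moment/atom combination (the kernel twin of the TWOTERM scan, every entry decidable
  by `norm_num` at concrete `(R, p, q, x, z)`);
* the FULL-GAP EDGE SEQUENCE `b = (1, J−½, J+½)` with witness `u_J = k₁ + (−1)^J k_J` is evaluated in the companion
  file `ObjectiveTwinDetFullGapEdge` (`J = 2`: `−4 − 7π/6`; `J = 5`: `−704/175 − 316π/315`); DESK closed form for all
  `J ≥ 2` (seat folder scratch/fullgap.py, these formulas in exact arithmetic; NOT a theorem here):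
  `−4 − π − π/(J(2J−1)(2J−3)) − [J odd]·4/(J²(2J−3)) → −(4+π)` (lineage A's conjectured limit, confirmed at the desk).

Theorems only; no new definitions.
-/

noncomputable section

open Complex Real ComplexConjugate Set intervalIntegral
open _root_.MeasureTheory

namespace Literature.NumberTheory.LFunctions.Zhang2022

namespace Det

open Repair Objective

/-! ## Mode integrals for arbitrary frequencies -/

/-- `E(j) = ∫₀¹ k_j = ((−1)^j − 1)/c_j` for `j ≠ 0` (`primitive_afeDir` at `1`). [cite: Zhang2022LandauSiegel, §2 (2.13)] -/
theorem integral_afeDir_eq {j : ℕ} (hj : j ≠ 0) :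
    ∫ y in (0:ℝ)..1, afeDir j y = ((-1 : ℂ) ^ j - 1) / afeFreq j := by
  rw [primitive_afeDir hj, afeDir_one]

/-- interval integrability of `k_m`. [folklore] -/
private theorem ii_afeDir₁₈ (m : ℕ) (a b : ℝ) : IntervalIntegrable (afeDir m) volume a b :=
  (continuous_afeDir m).intervalIntegrable a b

/-! ## The two-term profile `u = x·k_p + z·k_q`, `p ≤ q` -/

/-- `u·ū = (|x|² + |z|²) + zx̄·k_{q−p} + xz̄·conj k_{q−p}` pointwise (`p ≤ q`). [cite: Zhang2022LandauSiegel, §2 (2.13)] -/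
theorem twoTerm_mul_conj {p q : ℕ} (hpq : p ≤ q) (x z : ℂ) (y : ℝ) :
    (x * afeDir p y + z * afeDir q y) * conj (x * afeDir p y + z * afeDir q y) =
      (x * conj x + z * conj z) + z * conj x * afeDir (q - p) y + x * conj z * conj (afeDir (q - p) y) := by
  have hpp : afeDir p y * conj (afeDir p y) = 1 := afeDir_mul_conj p y
  have hqq : afeDir q y * conj (afeDir q y) = 1 := afeDir_mul_conj q y
  have hqp : afeDir q y * conj (afeDir p y) = afeDir (q - p) y := afeDir_mul_conj_afeDir_of_le hpq y
  have hpq' : afeDir p y * conj (afeDir q y) = conj (afeDir (q - p) y) := afeDir_mul_conj_afeDir_of_ge hpq y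
  simp only [map_add, map_mul]
  linear_combination (x * conj x) * hpp + (z * conj z) * hqq + (z * conj x) * hqp + (x * conj z) * hpq'

/-- **`‖u‖²` for the two-term profile** (as a complex number): `∫₀¹ u ū = |x|² + |z|² + zx̄·E(q−p) + xz̄·conj E(q−p)`.
[cite: Zhang2022LandauSiegel, §2 (2.13)] -/
theorem integral_twoTerm_mul_conj {p q : ℕ} (hpq : p ≤ q) (x z : ℂ) :
    ∫ y in (0:ℝ)..1, (x * afeDir p y + z * afeDir q y) * conj (x * afeDir p y + z * afeDir q y) =
      (x * conj x + z * conj z) + z * conj x * (∫ y in (0:ℝ)..1, afeDir (q - p) y)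
        + x * conj z * conj (∫ y in (0:ℝ)..1, afeDir (q - p) y) := by
  simp_rw [twoTerm_mul_conj hpq]
  have h := integral_modes5 p q (q - p) (x * conj x + z * conj z) 0 0 (z * conj x) (x * conj z)
  simp only [zero_mul, add_zero] at h
  rw [← h]

/-- `‖u‖²_{L²}` as a real number. [cite: Zhang2022LandauSiegel, §2 (2.13)] -/
theorem integral_normSq_twoTerm {p q : ℕ} (hpq : p ≤ q) (x z : ℂ) :
    ∫ y in (0:ℝ)..1, ‖x * afeDir p y + z * afeDir q y‖ ^ 2 =
      ((x * conj x + z * conj z) + z * conj x * (∫ y in (0:ℝ)..1, afeDir (q - p) y)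
        + x * conj z * conj (∫ y in (0:ℝ)..1, afeDir (q - p) y)).re := by
  have key := intervalIntegral_mul_conj_self (fun y => x * afeDir p y + z * afeDir q y)
  rw [integral_twoTerm_mul_conj hpq] at key
  have hre := congrArg Complex.re key
  rw [Complex.ofReal_re] at hre
  exact hre.symm

/-- `u′ = (x c_p)·k_p + (z c_q)·k_q` pointwise. [cite: Zhang2022LandauSiegel, §2 (2.13)] -/
theorem twoTerm'_eq (p q : ℕ) (x z : ℂ) (y : ℝ) :
    x * afeDir' p y + z * afeDir' q y = (x * afeFreq p) * afeDir p y + (z * afeFreq q) * afeDir q y := by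
  simp only [afeDir']; ring

/-- **`⟨u′, u⟩ = ∫₀¹ u′ ū`**: `x c_p x̄ + z c_q z̄ + z c_q x̄·E(q−p) + x c_p z̄·conj E(q−p)`. [cite: Zhang2022LandauSiegel, §2 (2.10), (2.13)] -/
theorem integral_twoTerm'_mul_conj {p q : ℕ} (hpq : p ≤ q) (x z : ℂ) :
    ∫ y in (0:ℝ)..1, (x * afeDir' p y + z * afeDir' q y) * conj (x * afeDir p y + z * afeDir q y) =
      (x * afeFreq p * conj x + z * afeFreq q * conj z)
        + z * afeFreq q * conj x * (∫ y in (0:ℝ)..1, afeDir (q - p) y)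
        + x * afeFreq p * conj z * conj (∫ y in (0:ℝ)..1, afeDir (q - p) y) := by
  have hpt : ∀ y : ℝ, (x * afeDir' p y + z * afeDir' q y) * conj (x * afeDir p y + z * afeDir q y) =
      (x * afeFreq p * conj x + z * afeFreq q * conj z) + 0 * afeDir p y + 0 * afeDir q y
        + (z * afeFreq q * conj x) * afeDir (q - p) y + (x * afeFreq p * conj z) * conj (afeDir (q - p) y) := by
    intro y
    have hpp : afeDir p y * conj (afeDir p y) = 1 := afeDir_mul_conj p y
    have hqq : afeDir q y * conj (afeDir q y) = 1 := afeDir_mul_conj q y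
    have hqp : afeDir q y * conj (afeDir p y) = afeDir (q - p) y := afeDir_mul_conj_afeDir_of_le hpq y
    have hpq' : afeDir p y * conj (afeDir q y) = conj (afeDir (q - p) y) := afeDir_mul_conj_afeDir_of_ge hpq y
    simp only [afeDir', map_add, map_mul]
    linear_combination (x * afeFreq p * conj x) * hpp + (z * afeFreq q * conj z) * hqq
      + (z * afeFreq q * conj x) * hqp + (x * afeFreq p * conj z) * hpq'
  simp_rw [hpt]
  rw [integral_modes5]
  ring

/-- **`‖u′‖²_{L²}`** (real): the Gram expression at the coefficients `x c_p, z c_q`. [cite: Zhang2022LandauSiegel, §2 (2.10), (2.13)] -/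
theorem integral_normSq_twoTerm' {p q : ℕ} (hpq : p ≤ q) (x z : ℂ) :
    ∫ y in (0:ℝ)..1, ‖x * afeDir' p y + z * afeDir' q y‖ ^ 2 =
      (((x * afeFreq p) * conj (x * afeFreq p) + (z * afeFreq q) * conj (z * afeFreq q))
        + (z * afeFreq q) * conj (x * afeFreq p) * (∫ y in (0:ℝ)..1, afeDir (q - p) y)
        + (x * afeFreq p) * conj (z * afeFreq q) * conj (∫ y in (0:ℝ)..1, afeDir (q - p) y)).re := by
  simp_rw [twoTerm'_eq]
  exact integral_normSq_twoTerm hpq _ _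

/-- **`∫₀¹ u = x·E(p) + z·E(q)`**. [cite: Zhang2022LandauSiegel, §2 (2.13)] -/
theorem integral_twoTerm (p q : ℕ) (x z : ℂ) :
    ∫ y in (0:ℝ)..1, (x * afeDir p y + z * afeDir q y) =
      x * (∫ y in (0:ℝ)..1, afeDir p y) + z * (∫ y in (0:ℝ)..1, afeDir q y) := by
  have h1 := (ii_afeDir₁₈ p 0 1).const_mul x
  have h2 := (ii_afeDir₁₈ q 0 1).const_mul z
  rw [intervalIntegral.integral_add h1 h2, intervalIntegral.integral_const_mul, intervalIntegral.integral_const_mul]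

/-- **The primitive**: `∫₀ᵗ u = x(k_p(t) − 1)/c_p + z(k_q(t) − 1)/c_q` (`p, q ≠ 0`). [cite: Zhang2022LandauSiegel, §2 (2.13)] -/
theorem primitive_twoTerm {p q : ℕ} (hp : p ≠ 0) (hq : q ≠ 0) (x z : ℂ) (t : ℝ) :
    ∫ s in (0:ℝ)..t, (x * afeDir p s + z * afeDir q s) =
      x * ((afeDir p t - 1) / afeFreq p) + z * ((afeDir q t - 1) / afeFreq q) := by
  have h1 := (ii_afeDir₁₈ p 0 t).const_mul x
  have h2 := (ii_afeDir₁₈ q 0 t).const_mul z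
  rw [intervalIntegral.integral_add h1 h2, intervalIntegral.integral_const_mul, intervalIntegral.integral_const_mul,
    primitive_afeDir hp, primitive_afeDir hq]

/-- **`⟨u, S_u⟩ = ∫₀¹ u·conj(∫₀ʸ u)`** in closed form (`1 ≤ p ≤ q`): with `w_p = conj(x/c_p)`, `w_q = conj(z/c_q)`,
`∫ u·conj S_u = x w_p + z w_q − (w_p + w_q)·(xE(p) + zE(q)) + z w_p E(q−p) + x w_q conj E(q−p)`.
[cite: Zhang2022LandauSiegel, §2 (2.13)] -/
theorem integral_twoTerm_mul_conj_primitive {p q : ℕ} (hp : p ≠ 0) (hpq : p ≤ q) (x z : ℂ) :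
    ∫ y in (0:ℝ)..1, (x * afeDir p y + z * afeDir q y) *
        conj (∫ s in (0:ℝ)..y, (x * afeDir p s + z * afeDir q s)) =
      (x * conj (x / afeFreq p) + z * conj (z / afeFreq q))
        - (conj (x / afeFreq p) + conj (z / afeFreq q)) *
            (x * (∫ y in (0:ℝ)..1, afeDir p y) + z * (∫ y in (0:ℝ)..1, afeDir q y))
        + z * conj (x / afeFreq p) * (∫ y in (0:ℝ)..1, afeDir (q - p) y)
        + x * conj (z / afeFreq q) * conj (∫ y in (0:ℝ)..1, afeDir (q - p) y) := by
  have hq : q ≠ 0 := fun h => hp (Nat.le_zero.mp (h ▸ hpq))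
  have hpt : ∀ y : ℝ, (x * afeDir p y + z * afeDir q y) * conj (∫ s in (0:ℝ)..y, (x * afeDir p s + z * afeDir q s)) =
      (x * conj (x / afeFreq p) + z * conj (z / afeFreq q))
        + (-(conj (x / afeFreq p) + conj (z / afeFreq q)) * x) * afeDir p y
        + (-(conj (x / afeFreq p) + conj (z / afeFreq q)) * z) * afeDir q y
        + (z * conj (x / afeFreq p)) * afeDir (q - p) y
        + (x * conj (z / afeFreq q)) * conj (afeDir (q - p) y) := by
    intro y
    rw [primitive_twoTerm hp hq]
    have hpp : afeDir p y * conj (afeDir p y) = 1 := afeDir_mul_conj p y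
    have hqq : afeDir q y * conj (afeDir q y) = 1 := afeDir_mul_conj q y
    have hqp : afeDir q y * conj (afeDir p y) = afeDir (q - p) y := afeDir_mul_conj_afeDir_of_le hpq y
    have hpq' : afeDir p y * conj (afeDir q y) = conj (afeDir (q - p) y) := afeDir_mul_conj_afeDir_of_ge hpq y
    have e1 : conj (x * ((afeDir p y - 1) / afeFreq p)) = conj (x / afeFreq p) * (conj (afeDir p y) - 1) := by
      simp only [map_mul, map_div₀, map_sub, map_one]; ring
    have e2 : conj (z * ((afeDir q y - 1) / afeFreq q)) = conj (z / afeFreq q) * (conj (afeDir q y) - 1) := by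
      simp only [map_mul, map_div₀, map_sub, map_one]; ring
    rw [map_add, e1, e2]
    linear_combination (x * conj (x / afeFreq p)) * hpp + (z * conj (z / afeFreq q)) * hqq
      + (z * conj (x / afeFreq p)) * hqp + (x * conj (z / afeFreq q)) * hpq'
  simp_rw [hpt]
  rw [integral_modes5]
  ring

/-- A two-term exponential profile is a kinked profile. [cite: Zhang2022LandauSiegel, §7 Prop 7.1 (7.2)] -/
theorem kinkedProfile_twoTerm (p q : ℕ) (x z : ℂ) :
    KinkedProfile (fun y => x * afeDir p y + z * afeDir q y) (fun y => x * afeDir' p y + z * afeDir' q y) := by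
  have h := ((kinkedProfile_afeDir p).smul x).add_smul (kinkedProfile_afeDir q) z
  exact h

/-! ## Formula I of any recipe on a two-term one-sided profile -/

/-- **ANY recipe on ANY two-term one-sided exponential profile** `u = x·k_p + z·k_q` (`1 ≤ p < q`,
`x(−1)^p + z(−1)^q = 0`): `FormDet R u` is `Det.formDet_eq_moments` with the six atoms in closed form
(`E(j) = ((−1)^j − 1)/c_j`). [cite: Zhang2022LandauSiegel, Prop 7.1 p.44 with (8.11)–(8.23); §2 (2.13)] -/
theorem formDet_recipe_twoTerm (R : DetRecipe) {p q : ℕ} (hp : p ≠ 0) (hpq : p < q) (x z : ℂ)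
    (h1 : x * (-1) ^ p + z * (-1) ^ q = 0) :
    FormDet R (fun y => x * afeDir p y + z * afeDir q y) (fun y => x * afeDir' p y + z * afeDir' q y) =
      2 / π * (∑ j : Fin 3, R.W j).re *
          (((x * afeFreq p) * conj (x * afeFreq p) + (z * afeFreq q) * conj (z * afeFreq q))
            + (z * afeFreq q) * conj (x * afeFreq p) * (((-1 : ℂ) ^ (q - p) - 1) / afeFreq (q - p))
            + (x * afeFreq p) * conj (z * afeFreq q) * conj (((-1 : ℂ) ^ (q - p) - 1) / afeFreq (q - p))).re
        + 2 * ((∑ j : Fin 3, R.W j * (R.s j : ℂ)) *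
            ((x * afeFreq p * conj x + z * afeFreq q * conj z)
              + z * afeFreq q * conj x * (((-1 : ℂ) ^ (q - p) - 1) / afeFreq (q - p))
              + x * afeFreq p * conj z * conj (((-1 : ℂ) ^ (q - p) - 1) / afeFreq (q - p)))).im
        - 2 * ((∑ j : Fin 3, R.W j * (R.b j : ℂ)) *
            conj ((x * afeFreq p * conj x + z * afeFreq q * conj z)
              + z * afeFreq q * conj x * (((-1 : ℂ) ^ (q - p) - 1) / afeFreq (q - p))
              + x * afeFreq p * conj z * conj (((-1 : ℂ) ^ (q - p) - 1) / afeFreq (q - p)))).im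
        + 2 * π * ((∑ j : Fin 3, R.W j * (R.n j : ℂ)) + ∑ j : Fin 3, R.W j * ((R.b j : ℂ) * (R.s j : ℂ))).re *
            ((x * conj x + z * conj z) + z * conj x * (((-1 : ℂ) ^ (q - p) - 1) / afeFreq (q - p))
              + x * conj z * conj (((-1 : ℂ) ^ (q - p) - 1) / afeFreq (q - p))).re
        - 2 * π * ((∑ j : Fin 3, R.W j * (R.n j : ℂ)) *
            ((x + z) * conj (x * (((-1 : ℂ) ^ p - 1) / afeFreq p) + z * (((-1 : ℂ) ^ q - 1) / afeFreq q)))).re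
        - 2 * π ^ 2 * ((∑ j : Fin 3, R.W j * ((R.b j : ℂ) * (R.n j : ℂ))) *
            ((x * (((-1 : ℂ) ^ p - 1) / afeFreq p) + z * (((-1 : ℂ) ^ q - 1) / afeFreq q)) *
                conj (x * (((-1 : ℂ) ^ p - 1) / afeFreq p) + z * (((-1 : ℂ) ^ q - 1) / afeFreq q))
              - ((x * conj (x / afeFreq p) + z * conj (z / afeFreq q))
                  - (conj (x / afeFreq p) + conj (z / afeFreq q)) *
                    (x * (((-1 : ℂ) ^ p - 1) / afeFreq p) + z * (((-1 : ℂ) ^ q - 1) / afeFreq q))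
                  + z * conj (x / afeFreq p) * (((-1 : ℂ) ^ (q - p) - 1) / afeFreq (q - p))
                  + x * conj (z / afeFreq q) * conj (((-1 : ℂ) ^ (q - p) - 1) / afeFreq (q - p))))).im := by
  have hq : q ≠ 0 := Nat.ne_zero_of_lt hpq
  have hd : q - p ≠ 0 := Nat.sub_ne_zero_of_lt hpq
  set u : ℝ → ℂ := fun y => x * afeDir p y + z * afeDir q y with hu
  set u' : ℝ → ℂ := fun y => x * afeDir' p y + z * afeDir' q y with hu'
  have hg : KinkedProfile u u' := kinkedProfile_twoTerm p q x z
  have hu1 : u 1 = 0 := by simp only [hu, afeDir_one]; exact h1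
  have hu0 : u 0 = x + z := by simp only [hu, afeDir_zero]; ring
  rw [formDet_eq_moments hg hu1]
  have hT0 := integral_normSq_twoTerm' hpq.le x z
  have hT1 := integral_twoTerm'_mul_conj hpq.le x z
  have hT1c : ∫ y in (0:ℝ)..1, u y * conj (u' y) = conj (∫ y in (0:ℝ)..1, u' y * conj (u y)) := by
    rw [intervalIntegral.integral_of_le zero_le_one, intervalIntegral.integral_of_le zero_le_one, ← integral_conj]
    refine setIntegral_congr_fun measurableSet_Ioc fun y _ => ?_
    simp only [map_mul, RingHomCompTriple.comp_apply, RingHom.id_apply, mul_comm]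
  have hG := integral_normSq_twoTerm hpq.le x z
  have hI := integral_twoTerm p q x z
  have hT4 := integral_twoTerm_mul_conj_primitive hp hpq.le x z
  rw [hu0, hT1c]
  simp only [hu, hu'] at hT0 hT1 hG hI hT4 ⊢
  rw [hT0, hT1, hG, hI, hT4, integral_afeDir_eq hp, integral_afeDir_eq hq, integral_afeDir_eq hd]

end Det

end Literature.NumberTheory.LFunctions.Zhang2022
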